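import Summits.BirchSwinnertonDyer.Rank1Residual.ManinAdditive.CuspidalKummerClass
import HarnessLib
import HarnessLib.Audit.Tags

/-!
# The TOTALLY-BLIND residual of C2 is ONE one-parameter family `y² = (x + u)(x² + 4)`, `u ∈ ℤ` — E-an-50♯ / E-an-50R typed
# (cell `bsd-f2-manin`, seat -an gen 31, MEMO-an §74; TURNKEY-an-20; typer g17)

TYPER NOTE.  SOURCE = HOME/an/g31/Sketch-an-g31b.lean sha16 7f91e91ddb9683e1 (68 l.; farm rc 0 · 0 err · 0 warn · 0 sorry per an;
BC7 2/2 CLEAN, Sketch-an-g31b.bc7.txt), landed VERBATIM as a sibling leaf of `CuspidalKummerClass.lean` (same namespace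
`…ManinAdditive.CuspidalKummer`) except for this note and the two `HarnessLib` imports.  Two `@[conjecture]` obligation nodes (nothing
asserted): **E-an-50♯ `TotallyBlindIsUFamily`** (census law, c-free) and **E-an-50R `UFamilyManinOdd`** (C2 on the family); the
definition `IsUFamilyModel`; PROVED `kummerBlindAtTwo_of_uFamily`, `uFamily_cubic_root` and the split
`kummerBlindResidualOdd_of : TotallyBlindIsUFamily → UFamilyManinOdd → KummerBlindResidualOdd` (E-an-50 = 50♯ ∧ 50R).
BC5: 20/20 totally-blind optimal classes with `4 ∣ N ≤ 5000` are `u`-family models (two engines: an g14 2-adic squares; data D-an-10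
PART 1 modular symbols 14/14 for `N ≤ 1760`); REFUTER VERDICTS: R-an-55 (ref1 A1–A6) PENDING at filing — repairs under NEW names.
bears_on: stmt-BirchSwinnertonDyer-22967 (C2 `ManinOddAtFour`, residual «Rb blind»).
[cite: CesnaviciusNeururerSaha2023, Thm. 1.1 (shape only: the print bound that settles the `v₂(N) = 2` members; the family law is the cell's, NOT in print)]

Census (two engines, MEMO-an §74.2): every optimal `E₀` with `4 ∣ N ≤ 5000` all of whose rational 2-torsion is
Kummer-blind has reduced model `y² = (x + u)(x² + 4)` up to translation — 20/20 classes (`u ≡ 1 (4)`: `N = 4(u²+4)`,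
IV* at 2; `u ≡ 3 (4)`: `N = 16(u²+4)`, I₀*; `u = 0`: 32a1; `u = ±2`: 128b1/128d1); conversely every such model has exactly
one rational 2-torsion point `(−u, 0)` and it is blind (`kummerBlindAtTwo_of_uFamily`, proved below).  So E-an-50
`KummerBlindResidualOdd` SPLITS as  E-an-50♯ `TotallyBlindIsUFamily` (census law, c-free, decidable per curve)  ∧
E-an-50R `UFamilyManinOdd` (C2 on the family) — `kummerBlindResidualOdd_of` below.  Nothing is asserted.
PARTITION 0 · beyond-print theorem: no · BSD is not proved by this.
-/

noncomputable section
open PowerSeries CongruenceSubgroup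
open Literature.NumberTheory.EllipticCurves Literature.NumberTheory.EllipticCurves.ModularForms

namespace Summit.BirchSwinnertonDyer.Rank1Residual.ManinAdditive.CuspidalKummer

/-- `W` is the `u`-family model `y² = (x + u)(x² + 4)` translated by `s` (`x ↦ x + s`):
`a₁ = a₃ = 0`, `a₂ = 3s + u`, `a₄ = 3s² + 2su + 4`, `a₆ = (s + u)(s² + 4)`. (an g31, MEMO-an §74.) -/
def IsUFamilyModel (W : WeierstrassCurve ℚ) : Prop :=
  ∃ u s : ℤ, W.a₁ = 0 ∧ W.a₃ = 0 ∧ W.a₂ = (3 * s + u : ℤ) ∧ W.a₄ = (3 * s ^ 2 + 2 * s * u + 4 : ℤ) ∧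
    W.a₆ = ((s + u) * (s ^ 2 + 4) : ℤ)

/-- the rational 2-torsion point `e = −(s+u)` of a `u`-family model is Kummer-blind (`b = 2s`, `b² − 4c = −16`). -/
theorem kummerBlindAtTwo_of_uFamily (u s : ℤ) :
    KummerBlindAtTwo (3 * s + u) (3 * s ^ 2 + 2 * s * u + 4) (-(s + u)) := by
  refine ⟨⟨s, by ring⟩, ⟨-1, by ring⟩⟩

/-- `e = −(s+u)` is a root of the cubic `x³ + a₂x² + a₄x + a₆` of a `u`-family model (so it IS a 2-torsion abscissa). -/
theorem uFamily_cubic_root (u s : ℤ) :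
    (-(s + u)) ^ 3 + (3 * s + u) * (-(s + u)) ^ 2 + (3 * s ^ 2 + 2 * s * u + 4) * (-(s + u)) + (s + u) * (s ^ 2 + 4) = 0 := by
  ring

/-- **Candidate E-an-50♯ `TotallyBlindIsUFamily` (census LAW, c-free; cell bsd-f2-manin, an g31 MEMO-an §74; nothing asserted):**
an `X₀(N)`-optimal `W` with `4 ∣ N`, `a₁ = a₃ = 0`, a rational 2-torsion point, and EVERY rational 2-torsion point Kummer-blind
is a `u`-family model `y² = (x+u)(x²+4)` up to translation.  Evidence: 20/20 classes `N ≤ 5000` under two engines (an g14 2-adic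
squares; data D-an-10 PART 1 modular symbols, 14/14 for `N ≤ 1760`).  Falsifier: one optimal totally-blind curve outside the family. -/
@[conjecture]
def TotallyBlindIsUFamily : Prop :=
  ∀ (W : WeierstrassCurve ℚ) [W.IsElliptic] [W.IsGloballyMinimal] {N : ℕ} [NeZero N]
    (D : ModularParametrizationData W N),
    (∀ z ∈ D.L.lattice, ∃ w ∈ periodLattice D.f, z = D.c * w) → 4 ∣ N →
    ∀ (a₂ a₄ : ℤ), W.a₁ = 0 → W.a₃ = 0 → W.a₂ = a₂ → W.a₄ = a₄ →
    (∃ e : ℤ, W.twoTorsionPolynomial.toPoly.IsRoot (e : ℚ)) →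
    (∀ e : ℤ, W.twoTorsionPolynomial.toPoly.IsRoot (e : ℚ) → KummerBlindAtTwo a₂ a₄ e) →
    IsUFamilyModel W

/-- **Candidate E-an-50R `UFamilyManinOdd` (C2 on the blind family; cell bsd-f2-manin, an g31 MEMO-an §74; nothing asserted):**
the Manin constant of an `X₀(N)`-optimal `u`-family curve (`4 ∣ N`) is odd.  In print for the members with `v₂(N) = 2` and odd
modular degree (Česnavičius–Neururer–Saha bound, tier column CNS = 0: 20a1, 52a1, 116c1, 212b1, 692a1, 916a1, 1172a1); OPEN for
`N = 16(u²+4)` (80b1, 208c1, 464e1, 848d1, …) and `N ∈ {32, 128}`; `c = 1` individually by Cremona for every `N < 5·10⁵`. -/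
@[conjecture]
def UFamilyManinOdd : Prop :=
  ∀ (W : WeierstrassCurve ℚ) [W.IsElliptic] [W.IsGloballyMinimal] {N : ℕ} [NeZero N]
    (D : ModularParametrizationData W N),
    (∀ z ∈ D.L.lattice, ∃ w ∈ periodLattice D.f, z = D.c * w) → 4 ∣ N →
    IsUFamilyModel W → ¬ (2 : ℤ) ∣ D.maninConstant

/-- E-an-50 splits: census law ∧ C2-on-the-family ⟹ `KummerBlindResidualOdd`. -/
theorem kummerBlindResidualOdd_of (h₁ : TotallyBlindIsUFamily) (h₂ : UFamilyManinOdd) : KummerBlindResidualOdd :=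
  fun W _ _ _ _ D hopt h4 a₂ a₄ ha₁ ha₃ ha₂ ha₄ hex hall =>
    h₂ W D hopt h4 (h₁ W D hopt h4 a₂ a₄ ha₁ ha₃ ha₂ ha₄ hex hall)

end Summit.BirchSwinnertonDyer.Rank1Residual.ManinAdditive.CuspidalKummer
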